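import Mathlib.AlgebraicGeometry.Morphisms.FlatDescent
import Mathlib.AlgebraicGeometry.PullbackCarrier
import Literature.AlgebraicGeometry.Resolution.MinimalResolutionUnique
import HarnessLib

/-!
# Crux `NoZenoR` (stmt-ResolutionOfSingularities-19943), β layer, `stub_L1wCoreF` descent brick for BC-4:
# MINIMALITY OF A DESINGULARIZATION DESCENDS ALONG A FAITHFULLY FLAT QUASI-COMPACT BASE CHANGE

Route `ResolutionOfSingularities/HomologicalConductor`, crux chain W4.4.  OURS (cell res-hironaka, seat res-L0-w44-stub-2,
(L1)-PREP v4 §2, planner (ρ48): «minimality for the D2′ germ `S_f` DESCENDS along `S_f → Ŝ`»); AI-written, weaker than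
expert review; nothing here is a statement of the manuscript under review (Hironaka 2017).  Def-free, fact-free,
`--supports 19943 --as helper`.

Let `g : T' → T` be SURJECTIVE, FLAT and QUASI-COMPACT (e.g. `Spec Ŝ → Spec S_f` for a flat local homomorphism), `π : X → T`
a desingularization whose base change `π' : X' → T'` (`X' = X ×_T T'`, `σ : X' → X`) is a MINIMAL desingularization of
`T'`.  Suppose `T` has some minimal desingularization `ρ : Y → T` and base change along `g` carries desingularizations of
`T` to desingularizations of `T'`.  Then `π` is the minimal desingularization of `T`: the factorisation `h : X → Y` base
changes to an endomorphism-free situation upstairs, where `h' : X' → Y'` is an isomorphism (both are desingularizations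
and `X'` is minimal; tree `IsResolution.eq_id_of_comp_eq`), and isomorphisms DESCEND along surjective flat quasi-compact
morphisms (Mathlib's fpqc descent `descendsAlong_isomorphisms_surjective_inf_flat_inf_quasicompact`).

* `isIso_of_isMinimalResolution_of_fac` — a morphism from a minimal desingularization to a desingularization over the base
  is an isomorphism;
* `isMinimalResolution_of_iso_comp` — `e ≫ ρ` is minimal for an isomorphism `e` and `ρ` minimal;
* **`isMinimalResolution_of_baseChange`** — the descent statement.

Consumed by BC-4 (PREP v4 §2 / (ρ48)): Galois ascent `S → Ŝ` (`…NoZenoGaloisAscent.isMinimalResolution_of_flat_of_symmetric`)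
followed by this descent `Ŝ → S_f`.  References: A. Grothendieck, SGA 1 VIII / EGA IV₂ 2.7.1 (fpqc descent of
isomorphisms; Mathlib `Morphisms/FlatDescent`) [folklore]; J. Lipman, Publ. Math. IHÉS 36 (1969) Thm (4.1) p. 204 and
Lemma (16.1) p. 231 (context) [`Lipman1969`].
-/

noncomputable section

-- single-problem summit: the doubled namespace component `ResolutionOfSingularities` is forced
set_option linter.dupNamespace false

namespace Summit.ResolutionOfSingularities.ResolutionOfSingularities.Theorems.NoZeno.ExcCount

open CategoryTheory AlgebraicGeometry Limits MorphismProperty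
open Literature.AlgebraicGeometry.Resolution

universe u

/-- **A morphism from a MINIMAL desingularization to a desingularization, over the base, is an isomorphism**: the
minimal one receives a map back, and desingularizations have no endomorphisms over the base but the identity.
[cite: Lipman1969, Theorem (4.1) (p. 204)] -/
theorem isIso_of_isMinimalResolution_of_fac {X Y T : Scheme.{u}} {π : X ⟶ T} {ρ : Y ⟶ T}
    (hπ : IsMinimalResolution π) (hρ : IsResolution ρ) (h : X ⟶ Y) (hh : h ≫ ρ = π) : IsIso h := by
  obtain ⟨k, hk⟩ := hπ.2 Y ρ hρ
  have h1 : h ≫ k = 𝟙 X := IsResolution.eq_id_of_comp_eq hπ.1 (h ≫ k) (by rw [Category.assoc, hk, hh])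
  have h2 : k ≫ h = 𝟙 Y := IsResolution.eq_id_of_comp_eq hρ (k ≫ h) (by rw [Category.assoc, hh, hk])
  exact ⟨k, h1, h2⟩

/-- Precomposing a minimal desingularization with an isomorphism gives a minimal desingularization. [folklore] -/
theorem isMinimalResolution_of_iso_comp {X Y T : Scheme.{u}} {ρ : Y ⟶ T} (hρ : IsMinimalResolution ρ)
    (h : X ⟶ Y) [IsIso h] {π : X ⟶ T} (hh : h ≫ ρ = π) (hπ : IsResolution π) : IsMinimalResolution π := by
  refine ⟨hπ, fun Z ψ hψ => ?_⟩
  obtain ⟨k, hk⟩ := hρ.2 Z ψ hψ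
  exact ⟨k ≫ inv h, by rw [Category.assoc, ← hh, IsIso.inv_hom_id_assoc, hk]⟩

/-- **MINIMALITY DESCENDS along a surjective flat quasi-compact base change.**  Let `g : T' → T` be surjective, flat and
quasi-compact, `π : X → T` a desingularization and `π' : X' → T'`, `σ : X' → X` a cartesian square over `g` with `π'` a
MINIMAL desingularization of `T'`.  If `T` admits a minimal desingularization and base change along `g` preserves
desingularizations of `T`, then `π` is the minimal desingularization of `T` (the factorisation `X → Y` through the minimal
`Y → T` becomes an isomorphism after base change — `X'` minimal, `Y'` a desingularization — and isomorphisms descend along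
`g`, Mathlib `descendsAlong_isomorphisms_surjective_inf_flat_inf_quasicompact`). [folklore] -/
theorem isMinimalResolution_of_baseChange {T T' X X' : Scheme.{u}} (g : T' ⟶ T) [Surjective g] [Flat g]
    [QuasiCompact g] {π : X ⟶ T} {π' : X' ⟶ T'} {σ : X' ⟶ X} (Hsq : IsPullback σ π' π g)
    (hπ : IsResolution π) (hπ' : IsMinimalResolution π')
    (hmin : ∃ (Y : Scheme.{u}) (ρ : Y ⟶ T), IsMinimalResolution ρ)
    (hbc : ∀ (Y : Scheme.{u}) (ρ : Y ⟶ T), IsResolution ρ → IsResolution (pullback.snd ρ g)) :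
    IsMinimalResolution π := by
  obtain ⟨Y, ρ, hρ⟩ := hmin
  obtain ⟨h, hh⟩ := hρ.2 X π hπ
  -- base change of `Y → T`
  have hρ' : IsResolution (pullback.snd ρ g) := hbc Y ρ hρ.1
  -- the base change `h' : X' → Y'` of `h`
  let h' : X' ⟶ pullback ρ g := pullback.lift (σ ≫ h) π' (by rw [Category.assoc, hh, Hsq.w])
  have hh' : h' ≫ pullback.snd ρ g = π' := pullback.lift_snd _ _ _
  -- the square `X' → Y'` over `X → Y` is cartesian (horizontal pasting with `Y' → T'` over `Y → T`)
  have hsq : IsPullback h' σ (pullback.fst ρ g) h := by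
    refine IsPullback.of_right (h₁₁ := h') (h₁₂ := pullback.snd ρ g) (h₂₁ := h) (h₂₂ := ρ)
      (v₁₁ := σ) (v₁₂ := pullback.fst ρ g) (v₁₃ := g) ?_ (pullback.lift_fst _ _ _) (IsPullback.of_hasPullback ρ g).flip
    rw [hh', hh]
    exact Hsq.flip
  -- upstairs `h'` is an isomorphism: `X'` is minimal and `Y'` is a desingularization
  haveI : IsIso h' := isIso_of_isMinimalResolution_of_fac hπ' hρ' h' hh'
  -- isomorphisms descend along the surjective flat quasi-compact `Y' → Y`
  have hQ : (@Surjective ⊓ @Flat ⊓ @QuasiCompact : MorphismProperty Scheme.{u}) (pullback.fst ρ g) :=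
    ⟨⟨inferInstance, inferInstance⟩, inferInstance⟩
  have hiso : (isomorphisms Scheme.{u}) h :=
    MorphismProperty.of_isPullback_of_descendsAlong (P := isomorphisms Scheme.{u})
      (Q := @Surjective ⊓ @Flat ⊓ @QuasiCompact) hsq hQ ((isomorphisms.iff _).mpr inferInstance)
  haveI : IsIso h := (isomorphisms.iff _).mp hiso
  exact isMinimalResolution_of_iso_comp hρ h hh hπ

end Summit.ResolutionOfSingularities.ResolutionOfSingularities.Theorems.NoZeno.ExcCount

end
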